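import Summits.CriticalPhenomena.PercolationContinuityZ3.Theorems.PercNearOneGluingNoHeavyLowerTailSahiHereditaryMeetAbsorption
import Literature.Combinatorics.Sahi2008.GeneratingFunction
import HarnessLib

/-!
# `NoHeavyLowerTail` (stmt-CriticalPhenomena-4575) — families DRAWN from a triplewise meet-contained family; Sahi's generating-function conjecture on the class

Support file, seat `prim-l12-p5` (gen 4), `--supports stmt-CriticalPhenomena-4575`.  No definitions, no named facts, no sorries.
Uses `…SahiHereditaryMeetAbsorption` (Theorem F: `sahiE_nonneg_of_triplewise_meetContainment` — among any three of the monotone indicators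
`g_0,…,g_{m−1}` one absorbs the product of the other two ⇒ `E_m(g) ≥ 0`, FKG weights) and the tree's form of Lieb–Sahi's Theorem 4.4
(`Literature…coeff_sahiSeries_nonneg_of_forall_sahiE_nonneg`: `E_n ≥ 0` on all tuples from a class ⇒ nonnegative coefficients of
`1 − ∏_x (1 − Σ_i f_i(x) t^i)^{μ(x)}` for sequences from the class).

* `absorbs_three_of_triplewise` / `triplewise_of_absorbs_three` — the three-slot absorber condition in DISJUNCTIVE form for ALL index triples
  (coincident indices are automatic for `{0,1}`-valued slots: `(1 − g_i)·g_i·g_l = 0`), and back; this form is stable under re-indexing.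
* `sahiE_comp_nonneg_of_triplewise` — for every `σ : Fin n → Fin m` (repetitions, omissions, any order) `E_n(g ∘ σ) ≥ 0`: the class of members
  of a triplewise meet-contained family is closed under drawing tuples.
* **`coeff_sahiSeries_nonneg_of_triplewise`** — hence SAHI'S GENERATING-FUNCTION CONJECTURE [Sahi 2008, Conj. 4 = Lieb–Sahi 2022, Conj. 1.2] holds
  for every sequence `f_1, f_2, …` drawn from such a family (`f_i = g_{σ(i)}`): all coefficients of `sahiSeries μ f` are `≥ 0`, for every FKG
  probability weight on a finite distributive lattice.  (Chains: tree `sahiSeries_coeff_nonneg_of_linearOrder`; cumulations: Sahi's Theorem 1;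
  here: any family in which among any three members one contains the meet of the other two.)
-/

namespace Summit.CriticalPhenomena.PercolationContinuityZ3.Theorems

namespace SahiHereditaryMeetAbsorption

open Finset Function Literature.Combinatorics.Sahi2008
open scoped Nat

variable {α : Type*} [Fintype α]

/-! ### Families drawn with repetition from a triplewise meet-contained family; Sahi's generating-function form on the class -/

section Drawn

omit [Fintype α] in
/-- The three-slot absorber condition in DISJUNCTIVE form for ALL index triples (coincident indices are automatic for `{0,1}`-valued slots).
[this file] -/
theorem absorbs_three_of_triplewise {m : ℕ} (g : Fin m → α → ℝ) (h01 : ∀ i a, g i a = 0 ∨ g i a = 1)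
    (htri : ∀ S : Finset (Fin m), S.card = 3 → ∃ p ∈ S, ∀ x, (1 - g p x) * ∏ i ∈ S.erase p, g i x = 0)
    (i j k : Fin m) :
    (∀ x, (1 - g i x) * (g j x * g k x) = 0) ∨ (∀ x, (1 - g j x) * (g i x * g k x) = 0) ∨
      (∀ x, (1 - g k x) * (g i x * g j x) = 0) := by
  have hself : ∀ (i l : Fin m) (x : α), (1 - g i x) * (g i x * g l x) = 0 := fun i l x => by
    rcases h01 i x with e | e <;> simp [e]
  by_cases hij : i = j
  · subst hij
    exact Or.inl (hself i k)
  by_cases hik : i = k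
  · subst hik
    refine Or.inl fun x => ?_
    rw [mul_comm (g j x)]
    exact hself i j x
  by_cases hjk : j = k
  · subst hjk
    refine Or.inr (Or.inl fun x => ?_)
    rw [mul_comm (g i x)]
    exact hself j i x
  obtain ⟨p, hp, habs⟩ := htri {i, j, k} (Finset.card_eq_three.mpr ⟨i, j, k, hij, hik, hjk, rfl⟩)
  simp only [Finset.mem_insert, Finset.mem_singleton] at hp
  rcases hp with rfl | rfl | rfl
  · refine Or.inl fun x => ?_
    have key := habs x
    rwa [Finset.erase_insert (by simp [hij, hik]), Finset.prod_pair hjk] at key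
  · refine Or.inr (Or.inl fun x => ?_)
    have key := habs x
    rwa [Finset.insert_comm, Finset.erase_insert (by simp [Ne.symm hij, hjk]), Finset.prod_pair hik] at key
  · refine Or.inr (Or.inr fun x => ?_)
    have key := habs x
    rwa [show ({i, j, p} : Finset (Fin m)) = {p, i, j} by ext; simp only [Finset.mem_insert, Finset.mem_singleton]; tauto,
      Finset.erase_insert (by simp [Ne.symm hik, Ne.symm hjk]), Finset.prod_pair hij] at key

omit [Fintype α] in
/-- Conversely, the disjunctive three-slot condition on distinct slots gives the `Finset` form. [this file] -/
theorem triplewise_of_absorbs_three {n : ℕ} (h : Fin n → α → ℝ)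
    (H : ∀ a b c : Fin n, a ≠ b → a ≠ c → b ≠ c →
      (∀ x, (1 - h a x) * (h b x * h c x) = 0) ∨ (∀ x, (1 - h b x) * (h a x * h c x) = 0) ∨
        (∀ x, (1 - h c x) * (h a x * h b x) = 0))
    (S : Finset (Fin n)) (hS : S.card = 3) : ∃ p ∈ S, ∀ x, (1 - h p x) * ∏ i ∈ S.erase p, h i x = 0 := by
  obtain ⟨a, b, c, hab, hac, hbc, rfl⟩ := Finset.card_eq_three.mp hS
  rcases H a b c hab hac hbc with H1 | H2 | H3
  · refine ⟨a, by simp, fun x => ?_⟩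
    rw [Finset.erase_insert (by simp [hab, hac]), Finset.prod_pair hbc]
    exact H1 x
  · refine ⟨b, by simp, fun x => ?_⟩
    rw [Finset.insert_comm, Finset.erase_insert (by simp [Ne.symm hab, hbc]), Finset.prod_pair hac]
    exact H2 x
  · refine ⟨c, by simp, fun x => ?_⟩
    rw [show ({a, b, c} : Finset (Fin n)) = {c, a, b} by ext; simp only [Finset.mem_insert, Finset.mem_singleton]; tauto,
      Finset.erase_insert (by simp [Ne.symm hac, Ne.symm hbc]), Finset.prod_pair hab]
    exact H3 x

variable [DistribLattice α]

/-- **Families DRAWN from a triplewise meet-contained family** (repetitions and reordering allowed): for every `σ : Fin n → Fin m`,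
`E_n(g_{σ(0)},…,g_{σ(n−1)}) ≥ 0` (a repeated slot absorbs: `(1 − g_i)·g_i·g_l = 0`). [this file] -/
theorem sahiE_comp_nonneg_of_triplewise {μ : α → ℝ} (hμ : IsFKGMeasure μ) (m : ℕ) (g : Fin m → α → ℝ)
    (h01 : ∀ i a, g i a = 0 ∨ g i a = 1) (hmono : ∀ i, Monotone (g i))
    (htri : ∀ S : Finset (Fin m), S.card = 3 → ∃ p ∈ S, ∀ x, (1 - g p x) * ∏ i ∈ S.erase p, g i x = 0)
    (n : ℕ) (σ : Fin n → Fin m) : 0 ≤ sahiE μ n (fun j => g (σ j)) :=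
  sahiE_nonneg_of_triplewise_meetContainment hμ n _ (fun j a => h01 (σ j) a) (fun j => hmono (σ j))
    (triplewise_of_absorbs_three _ fun a b c _ _ _ => absorbs_three_of_triplewise g h01 htri (σ a) (σ b) (σ c))

/-- **Sahi's GENERATING-FUNCTION conjecture (Conj. 4 of Sahi 2008 = Conj. 1.2 of Lieb–Sahi) on the class**: for an FKG probability weight and a
triplewise meet-contained family `g` of monotone indicators, every sequence `f_1, f_2, …` DRAWN from the family (`f_i = g_{σ(i)}`) has
`1 − ∏_x (1 − Σ_i f_i(x) t^i)^{μ(x)}` with all coefficients `≥ 0` (Lieb–Sahi Thm 4.4 ⇒, tree `coeff_sahiSeries_nonneg_of_forall_sahiE_nonneg`,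
applied to the class of members of the family). [this file] -/
theorem coeff_sahiSeries_nonneg_of_triplewise {μ : α → ℝ} (hμ : IsFKGMeasure μ) (m : ℕ) (g : Fin m → α → ℝ)
    (h01 : ∀ i a, g i a = 0 ∨ g i a = 1) (hmono : ∀ i, Monotone (g i))
    (htri : ∀ S : Finset (Fin m), S.card = 3 → ∃ p ∈ S, ∀ x, (1 - g p x) * ∏ i ∈ S.erase p, g i x = 0)
    (f : ℕ → α → ℝ) (hf : ∀ i, ∃ j, f i = g j) (M : ℕ) : 0 ≤ PowerSeries.coeff M (sahiSeries μ f) := by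
  refine coeff_sahiSeries_nonneg_of_forall_sahiE_nonneg μ hμ.sum_eq_one (fun h => ∃ j, h = g j) ?_ f hf M
  intro n h hh
  choose σ hσ using hh
  have e : h = fun j => g (σ j) := funext hσ
  rw [e]
  exact sahiE_comp_nonneg_of_triplewise hμ m g h01 hmono htri n σ

end Drawn

end SahiHereditaryMeetAbsorption

end Summit.CriticalPhenomena.PercolationContinuityZ3.Theorems
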